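import Mathlib
import Literature.MathematicalPhysics.QuantumManyBody.BoseEinsteinCondensation
import Literature.MathematicalPhysics.QuantumManyBody.BoseGasThermodynamicLimitRuelle
import Summits.AtomisticToContinuum.BoseEinsteinCondensation.Theorems.SoloBlindFragmentedStates

/-!
# Energy windows containing a two-region energy certify at most `max N₁ N₂`

Solo-blind residency `solo-AtomisticToContinuum-blind`, session 3 (kernel part of the no-go
Proposition 11.1 of the working paper), continuation of `SoloBlindFragmentedStates`.

* `window_iInf_maxOccupation_le_of_rawEnergy`, `…_of_infEnergy` — an energy window of width `w`
  above `E₀(N₁ + N₂, L)` that contains the two-region energy `E(N₁, U₁) + E(N₂, U₂)` (regions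
  inside the box, separated by more than the range of `v`) certifies at most `max N₁ N₂`
  condensed particles: the window infimum of `maxOccupation` entering `condensateNumber` is
  `≤ max N₁ N₂`.
* `window_iInf_maxOccupation_le_twoBoxes` — the concrete instance with two sub-cubes of side `ℓ`
  stacked along the third axis at distance `R`, `2ℓ + R ≤ L`: if
  `E₀(N₁, ℓ) + E₀(N₂, ℓ) < E₀(N₁ + N₂, L) + w` then the window infimum is `≤ max N₁ N₂`.

With `N₁ = N₂ = N/2`, `ℓ_N = (L_N - R)/2` and the existence and continuity of the thermodynamic
limit `e(ρ)` below the critical density (tree: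
`tendsto_energyPerParticleDirichlet_of_lt_criticalDensity`), the excess
`2 E₀(N/2, ℓ_N) - E₀(N, L_N)` is `o(N)`; so no criterion of the form
"`E(Ψ) ≤ E₀ + εN` ⇒ `maxOccupation Ψ ≥ cN`" with `c > 1/2` holds for the interacting dilute gas,
and, iterating the split, none with any `c > 0`: a proof of `HasGroundStateBEC` must enter the
window below the cost of one Dirichlet wall, conjecturally `O(N^{2/3})` (paper §11).
-/

noncomputable section

open MeasureTheory Filter Set
open scoped ENNReal NNReal ComplexConjugate

namespace Summit.AtomisticToContinuum.BoseEinsteinCondensation.Theorems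

open Literature.MathematicalPhysics.QuantumManyBody.BoseGas

/-! ### Energy windows containing a two-region energy certify at most `max N₁ N₂` -/

section Window

variable {v : ℝ → ℝ≥0∞} {R : ℝ} {N₁ N₂ : ℕ} {U₁ U₂ : Set Space} {L : ℝ}

/-- If two states supported in separated regions inside the box have total energy inside the
window `[E₀, E₀ + w]` of the `(N₁ + N₂)`-particle problem, the window infimum of `maxOccupation`
is at most `max N₁ N₂`. -/
theorem window_iInf_maxOccupation_le_of_rawEnergy (hv : Measurable v)
    (hv0 : ∀ r, R < r → v r = 0) (hU₁ : MeasurableSet U₁) (hU₂ : MeasurableSet U₂)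
    (hdisj : Disjoint U₁ U₂) (hsub : U₁ ∪ U₂ ⊆ box L)
    (hsep : ∀ x ∈ U₁, ∀ y ∈ U₂, R < dist x y)
    (Ψ₁ : SupportedState N₁ U₁) (Ψ₂ : SupportedState N₂ U₂) {w : ℝ≥0∞}
    (hw : rawEnergy v Ψ₁.ψ + rawEnergy v Ψ₂.ψ ≤ groundStateEnergy v (N₁ + N₂) L + w) :
    ⨅ (Φ : TrialState (N₁ + N₂) L) (_ : energy v Φ ≤ groundStateEnergy v (N₁ + N₂) L + w),
      maxOccupation (N₁ + N₂) Φ.ψ ≤ ((max N₁ N₂ : ℕ) : ℝ≥0∞) := by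
  set T : TrialState (N₁ + N₂) L := ((Ψ₁.merge Ψ₂ hdisj).mono hsub).toTrialState with hT
  have hE : energy v T = rawEnergy v Ψ₁.ψ + rawEnergy v Ψ₂.ψ := by
    rw [energy_eq_rawEnergy]
    exact rawEnergy_merge Ψ₁ Ψ₂ hdisj hv hv0 hsep
  calc ⨅ (Φ : TrialState (N₁ + N₂) L) (_ : energy v Φ ≤ groundStateEnergy v (N₁ + N₂) L + w),
        maxOccupation (N₁ + N₂) Φ.ψ
      ≤ maxOccupation (N₁ + N₂) T.ψ := iInf_maxOccupation_le v T (by rw [hE]; exact hw)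
    _ ≤ ((max N₁ N₂ : ℕ) : ℝ≥0∞) := maxOccupation_merge_le Ψ₁ Ψ₂ hdisj hU₁ hU₂

/-- The same with the two regional Dirichlet energies `E(N₁, U₁) + E(N₂, U₂)` strictly inside
the window. -/
theorem window_iInf_maxOccupation_le_of_infEnergy (hv : Measurable v)
    (hv0 : ∀ r, R < r → v r = 0) (hU₁ : MeasurableSet U₁) (hU₂ : MeasurableSet U₂)
    (hdisj : Disjoint U₁ U₂) (hsub : U₁ ∪ U₂ ⊆ box L)
    (hsep : ∀ x ∈ U₁, ∀ y ∈ U₂, R < dist x y) {w : ℝ≥0∞}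
    (hw : infEnergy v N₁ U₁ + infEnergy v N₂ U₂ < groundStateEnergy v (N₁ + N₂) L + w) :
    ⨅ (Φ : TrialState (N₁ + N₂) L) (_ : energy v Φ ≤ groundStateEnergy v (N₁ + N₂) L + w),
      maxOccupation (N₁ + N₂) Φ.ψ ≤ ((max N₁ N₂ : ℕ) : ℝ≥0∞) := by
  have h : (⨅ (Ψ₁ : SupportedState N₁ U₁) (Ψ₂ : SupportedState N₂ U₂),
      rawEnergy v Ψ₁.ψ + rawEnergy v Ψ₂.ψ) < groundStateEnergy v (N₁ + N₂) L + w := by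
    simp only [infEnergy] at hw
    rw [ENNReal.iInf_add] at hw
    simp_rw [ENNReal.add_iInf] at hw
    exact hw
  obtain ⟨Ψ₁, h₁⟩ := iInf_lt_iff.1 h
  obtain ⟨Ψ₂, h₂⟩ := iInf_lt_iff.1 h₁
  exact window_iInf_maxOccupation_le_of_rawEnergy hv hv0 hU₁ hU₂ hdisj hsub hsep Ψ₁ Ψ₂ h₂.le

/-! ### Two stacked sub-cubes -/

/-- A coordinate difference is bounded by the Euclidean distance. -/
theorem dist_coord_le_dist_space (x y : Space) (k : Fin 3) : dist (x k) (y k) ≤ dist x y := by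
  rw [EuclideanSpace.dist_eq]
  refine Real.le_sqrt_of_sq_le ?_
  exact Finset.single_le_sum (f := fun i => dist (x i) (y i) ^ 2)
    (fun i _ => sq_nonneg _) (Finset.mem_univ k)

/-- The shift vector `(0, 0, s)`. -/
def zShift (s : ℝ) : Space := EuclideanSpace.single (2 : Fin 3) s

/-- Third component of the shift vector. -/
@[simp] theorem zShift_apply_two (s : ℝ) : zShift s 2 = s := by
  simp [zShift]

/-- The other components of the shift vector vanish. -/
theorem zShift_apply_of_ne {s : ℝ} {k : Fin 3} (hk : k ≠ 2) : zShift s k = 0 := by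
  simp [zShift, hk]

/-- The upper sub-cube `Λ_ℓ + (0, 0, ℓ + R)`. -/
def stackedBox (ℓ R : ℝ) : Set Space := {x | x - zShift (ℓ + R) ∈ box ℓ}

/-- The upper sub-cube is measurable. -/
theorem measurableSet_stackedBox (ℓ R : ℝ) : MeasurableSet (stackedBox ℓ R) :=
  (measurableSet_box ℓ).preimage (measurable_id.sub measurable_const)

/-- Membership in the upper sub-cube, coordinatewise. -/
theorem mem_stackedBox {ℓ R : ℝ} {x : Space} :
    x ∈ stackedBox ℓ R ↔ ∀ k, x k - zShift (ℓ + R) k ∈ Set.Ioo 0 ℓ := by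
  simp [stackedBox, box]

/-- The two sub-cubes are separated by more than `R` (along the third axis). -/
theorem sep_box_stackedBox {ℓ R : ℝ} {x y : Space} (hx : x ∈ box ℓ) (hy : y ∈ stackedBox ℓ R) :
    R < dist x y := by
  have hx2 := (hx 2).2
  have hy2 := (mem_stackedBox.1 hy 2).1
  rw [zShift_apply_two] at hy2
  calc R < y 2 - x 2 := by linarith
    _ ≤ |x 2 - y 2| := by rw [abs_sub_comm]; exact le_abs_self _
    _ = dist (x 2) (y 2) := (Real.dist_eq _ _).symm
    _ ≤ dist x y := dist_coord_le_dist_space x y 2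

/-- The two sub-cubes are disjoint (`R ≥ 0`). -/
theorem disjoint_box_stackedBox {ℓ R : ℝ} (hR : 0 ≤ R) : Disjoint (box ℓ) (stackedBox ℓ R) :=
  Set.disjoint_left.2 fun x hx hx' => by
    have := sep_box_stackedBox hx hx'
    rw [dist_self] at this
    exact absurd this (not_lt.2 hR)

/-- Both sub-cubes lie in `Λ_L` when `2ℓ + R ≤ L`. -/
theorem box_union_stackedBox_subset {ℓ R L : ℝ} (hℓ : 0 < ℓ) (hR : 0 ≤ R)
    (hL : 2 * ℓ + R ≤ L) :
    box ℓ ∪ stackedBox ℓ R ⊆ box L := by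
  rintro x (hx | hx) k
  · exact ⟨(hx k).1, lt_of_lt_of_le (hx k).2 (by linarith)⟩
  · have hk := mem_stackedBox.1 hx k
    by_cases h2 : k = 2
    · subst h2
      rw [zShift_apply_two] at hk
      exact ⟨by linarith [hk.1], by linarith [hk.2]⟩
    · rw [zShift_apply_of_ne h2, sub_zero] at hk
      exact ⟨hk.1, lt_of_lt_of_le hk.2 (by linarith)⟩

/-- The upper sub-cube costs at most the Dirichlet energy of `Λ_ℓ` (translation invariance). -/
theorem infEnergy_stackedBox_le (v : ℝ → ℝ≥0∞) (N : ℕ) (ℓ R : ℝ) :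
    infEnergy v N (stackedBox ℓ R) ≤ groundStateEnergy v N ℓ := by
  rw [groundStateEnergy_eq_infEnergy]
  exact infEnergy_translate_le v N (box ℓ) (zShift (ℓ + R))

/-- **Two half-boxes in the window certify at most `max N₁ N₂`.** For a repulsive pair
potential vanishing beyond `R ≥ 0`, two sub-cubes of side `ℓ` stacked at distance `R` inside
`Λ_L` (`2ℓ + R ≤ L`): if `E₀(N₁, ℓ) + E₀(N₂, ℓ) < E₀(N₁ + N₂, L) + w`, then some state in the
energy window of width `w` has every mode occupied by at most `max N₁ N₂` particles, so the
window infimum of `maxOccupation` entering `condensateNumber` is `≤ max N₁ N₂`. -/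
theorem window_iInf_maxOccupation_le_twoBoxes (hv : Measurable v) (hR : 0 ≤ R)
    (hv0 : ∀ r, R < r → v r = 0) {ℓ : ℝ} (hℓ : 0 < ℓ) (hL : 2 * ℓ + R ≤ L) (N₁ N₂ : ℕ)
    {w : ℝ≥0∞}
    (hw : groundStateEnergy v N₁ ℓ + groundStateEnergy v N₂ ℓ
      < groundStateEnergy v (N₁ + N₂) L + w) :
    ⨅ (Φ : TrialState (N₁ + N₂) L) (_ : energy v Φ ≤ groundStateEnergy v (N₁ + N₂) L + w),
      maxOccupation (N₁ + N₂) Φ.ψ ≤ ((max N₁ N₂ : ℕ) : ℝ≥0∞) := by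
  refine window_iInf_maxOccupation_le_of_infEnergy hv hv0 (measurableSet_box ℓ)
    (measurableSet_stackedBox ℓ R) (disjoint_box_stackedBox hR)
    (box_union_stackedBox_subset hℓ hR hL) (fun x hx y hy => sep_box_stackedBox hx hy)
    (lt_of_le_of_lt ?_ hw)
  gcongr
  · exact (groundStateEnergy_eq_infEnergy v N₁ ℓ).symm.le
  · exact infEnergy_stackedBox_le v N₂ ℓ R

end Window

end Summit.AtomisticToContinuum.BoseEinsteinCondensation.Theorems
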